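import Literature.AnabelianGeometry.EtaleTheta.ClassicalThetaValues
import Literature.IUT.HodgeArakelov.ThetaEvaluationSubgraphs

/-!
# [IUTchII] Remark 2.5.1 (ii) / [IUTchI] Example 3.2 (iv): the theta values from the functional
# equation of `Θ̈` (discharge companion)

Proof-only companion (abc-iut cell, owner bridge duty MERGE-MAP §1: `ThetaEvaluationSubgraphs` ↔
the BUILT classical theta files of layer L2) of `Literature/IUT/HodgeArakelov/ThetaEvaluationSubgraphs.lean`
(p404618). It adds NO definitions. It discharges, from `Literature.AnabelianGeometry.EtaleTheta.thetaDdot`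
([EtTh] Prop 1.4, the series `Θ̈(Ü) = Σ_{n ∈ ℤ} (-1)^n q̈^{n(n+1)} Ü^{2n+1}`, `q̈ = q_X^{1/2}`) and its PROVED
functional equation `thetaDdot_zpow_mul` ([EtTh] Prop 1.4 (ii), third equation), the COMPUTATIONAL
clauses that [IUTchII] and [IUTchI] cite from [EtTh] Prop 1.4 (ii):

* [IUTchII] Remark 2.5.1 (ii), kurims Dec-2020 manuscript p. 73: "the reciprocals of the `l`-th powers
  of the theta values discussed in (i) [the `μ_{2l}`-orbits of `q_v^{j²}`, `q_v := q_v^{1/2l}`, typed as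
  `thetaValueAt`] correspond to the values `Θ̈(±√−1·q_X^{j/2})`, where `j ∈ {0, 1, …, l⋇}`, i.e., the values
  at points separated by periods [i.e., the `q_X^{j/2}`] from the point `±√−1`. These values may be
  computed easily from the functional equations given in [EtTh], Proposition 1.4, (ii)."
  PROVED: `thetaDdot_sqrt_neg_one_mul_zpow` (`Θ̈(±√−1·q̈^j) = q̈^{−j²}·Θ̈(±√−1)`, `j ∈ ℤ`) and
  `thetaValue_pow_mul_thetaDdot` / `thetaValueAt_pow_mul_thetaDdot` (for every element `x` of the
  `μ_{2l}`-orbit of `q^{j²}` with `q^{2l} = q̈²`: `x^l · Θ̈(±√−1·q̈^j) = ε · Θ̈(±√−1)` with `ε² = 1` — the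
  reciprocal of the `l`-th power of the theta value IS the value at `±√−1·q_X^{j/2}` normalised by the
  value at `±√−1`, up to sign).
* [IUTchI] Example 3.2 (iv), kurims May-2020 manuscript p. 71: "one computes immediately from the final
  formula of [EtTh], Proposition 1.4, (ii), that the value of `Θ_v` at `√−q_v` is equal to
  `q_v := q_v^{1/2l}`" — `Θ_v` being "the reciprocal of [the] `l`-th root of the theta function, …
  normalized so as to attain the value `1` at the point `√−1`" (Ex 3.2 (ii) p. 70). PROVED at the level of
  `Θ̈` (the `l`-th root itself lives on the tempered covering and is not a classical function):
  `thetaDdot_sqrt_neg_one_mul_self` (`Θ̈(√−1·q̈)·q̈ = Θ̈(√−1)`, so `(Θ̈(√−q_v)/Θ̈(√−1))^{−1} = q̈ = q_v^{1/2}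
  = (q_v^{1/2l})^l`).

Claim key `Mochizuki2012` DISPUTED (D-0012): what is proved here is classical `q`-series algebra over an
arbitrary normed field (no convergence hypothesis: the functional equation is a re-indexing identity of
`tsum`s); nothing here asserts a disputed claim or takes a side on [IUTchIII] Cor 3.12. The "crucial
property" of Remark 2.5.1 (ii) (ratios `Θ̈(c)/Θ̈(c')` for `c'` arising from automorphisms of `Π_v`) is
an anabelian statement and is NOT touched.
-/

namespace Literature.IUT.HodgeArakelov

open Literature.AnabelianGeometry.EtaleTheta

section Classical

variable {𝕜 : Type*} [NormedField 𝕜]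

/-- A square root of `−1` is nonzero (private helper). [folklore] -/
private theorem sqrt_neg_one_ne_zero {i : 𝕜} (hi : i ^ 2 = -1) : i ≠ 0 := by
  rintro rfl
  norm_num at hi

/-- For `i² = −1`: `i^{2j} = (−1)^j`, `j ∈ ℤ` (private helper). [folklore] -/
private theorem sqrt_neg_one_zpow_two_mul {i : 𝕜} (hi : i ^ 2 = -1) (j : ℤ) :
    i ^ (2 * j) = (-1 : 𝕜) ^ j := by
  rw [zpow_mul, ← hi]
  norm_cast

/-- **[IUTchII] Remark 2.5.1 (ii) p. 73 — "computed easily from the functional equations given in [EtTh],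
Proposition 1.4, (ii)"**: for `i² = −1`, `q̈ ≠ 0` and `j ∈ ℤ`,
`Θ̈(i · q̈^j) = q̈^{−j²} · Θ̈(i)`, i.e. `Θ̈(±√−1 · q_X^{j/2}) = q_X^{−j²/2} · Θ̈(±√−1)`: the sign
`(−1)^j` of the functional equation cancels against `(√−1)^{−2j} = (−1)^{−j}`.
[cite: Mochizuki2012, Rmk 2.5.1 (ii) p.73] -/
theorem thetaDdot_sqrt_neg_one_mul_zpow {i : 𝕜} (hi : i ^ 2 = -1) {q2 : 𝕜} (hq : q2 ≠ 0) (j : ℤ) :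
    thetaDdot q2 (i * q2 ^ j) = q2 ^ (-(j * j)) * thetaDdot q2 i := by
  have hi0 : i ≠ 0 := sqrt_neg_one_ne_zero hi
  have key : ((j.negOnePow : ℤ) : 𝕜) * i ^ (-(2 * j)) = 1 := by
    rw [Int.cast_negOnePow, zpow_neg, sqrt_neg_one_zpow_two_mul hi j, mul_inv_cancel₀]
    exact zpow_ne_zero _ (neg_ne_zero.mpr one_ne_zero)
  rw [mul_comm i, thetaDdot_zpow_mul hq hi0 j]
  calc ((j.negOnePow : ℤ) : 𝕜) * q2 ^ (-(j * j)) * i ^ (-(2 * j)) * thetaDdot q2 i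
      = (((j.negOnePow : ℤ) : 𝕜) * i ^ (-(2 * j))) * (q2 ^ (-(j * j)) * thetaDdot q2 i) := by ring
    _ = q2 ^ (-(j * j)) * thetaDdot q2 i := by rw [key, one_mul]

/-- The same at the other square root `−i` of `−1` (the "`±`" of "`Θ̈(±√−1 · q_X^{j/2})`", Remark 2.5.1
(ii) p. 73): `Θ̈(−i · q̈^j) = q̈^{−j²} · Θ̈(−i)`. [cite: Mochizuki2012, Rmk 2.5.1 (ii) p.73] -/
theorem thetaDdot_neg_sqrt_neg_one_mul_zpow {i : 𝕜} (hi : i ^ 2 = -1) {q2 : 𝕜} (hq : q2 ≠ 0)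
    (j : ℤ) : thetaDdot q2 (-i * q2 ^ j) = q2 ^ (-(j * j)) * thetaDdot q2 (-i) :=
  thetaDdot_sqrt_neg_one_mul_zpow (by rw [neg_sq, hi]) hq j

/-- Natural-number exponents (the `j ∈ {0, 1, …, l⋇}` of Remark 2.5.1 (ii) p. 73):
`Θ̈(i · q̈^j) · q̈^{j²} = Θ̈(i)`. [cite: Mochizuki2012, Rmk 2.5.1 (ii) p.73] -/
theorem thetaDdot_sqrt_neg_one_mul_pow {i : 𝕜} (hi : i ^ 2 = -1) {q2 : 𝕜} (hq : q2 ≠ 0) (j : ℕ) :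
    thetaDdot q2 (i * q2 ^ j) * q2 ^ (j ^ 2) = thetaDdot q2 i := by
  have h := thetaDdot_sqrt_neg_one_mul_zpow hi hq (j : ℤ)
  rw [zpow_natCast] at h
  rw [h, mul_comm, ← mul_assoc, ← zpow_natCast, Nat.cast_pow, ← zpow_add₀ hq]
  have : ((j : ℤ) ^ 2 + -((j : ℤ) * j)) = 0 := by ring
  rw [this, zpow_zero, one_mul]

/-- **[IUTchI] Example 3.2 (iv) p. 71 — "one computes immediately from the final formula of [EtTh],
Proposition 1.4, (ii), that the value of `Θ_v` at `√−q_v` is equal to `q_v^{1/2l}`"**, at the level of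
the classical series `Θ̈` (of which `Θ_v` is the reciprocal of an `l`-th root normalised to `1` at `√−1`,
Example 3.2 (ii) p. 70): `Θ̈(√−1 · q̈) · q̈ = Θ̈(√−1)`, where `√−q_v = √−1 · q̈`, `q̈² = q_v`; hence
`(Θ̈(√−q_v)/Θ̈(√−1))^{−1} = q̈ = (q_v^{1/2l})^l`. [cite: Mochizuki2012, Ex 3.2 (iv) p.71] -/
theorem thetaDdot_sqrt_neg_one_mul_self {i : 𝕜} (hi : i ^ 2 = -1) {q2 : 𝕜} (hq : q2 ≠ 0) :
    thetaDdot q2 (i * q2) * q2 = thetaDdot q2 i := by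
  simpa using thetaDdot_sqrt_neg_one_mul_pow hi hq 1

/-- In a field, a `2l`-th root `q` of `q̈²` has `q^l = ±q̈`, so `(q^{j²})^l = ±q̈^{j²}`: the `l`-th power of
the theta value `q^{j²}` is `q_X^{j²/2}` up to sign ([IUTchII] Remark 2.5.1 (ii) p. 73 with [IUTchI]
Example 3.2 (iv) p. 71: `q = q_v^{1/2l}`, `q̈ = q_v^{1/2}`). [cite: Mochizuki2012, Rmk 2.5.1 (ii) p.73] -/
theorem pow_sq_pow_eq_sign_mul {q q2 : 𝕜} {l : ℕ} (hq : q ^ (2 * l) = q2 ^ 2) (j : ℕ) :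
    ∃ ε : 𝕜, ε ^ 2 = 1 ∧ (q ^ (j ^ 2)) ^ l = ε * q2 ^ (j ^ 2) := by
  have hsq : (q ^ l) ^ 2 = q2 ^ 2 := by rw [← pow_mul, mul_comm, hq]
  rcases sq_eq_sq_iff_eq_or_eq_neg.mp hsq with h | h
  · refine ⟨1, one_pow 2, ?_⟩
    rw [one_mul, ← pow_mul, mul_comm, pow_mul, h]
  · refine ⟨(-1) ^ (j ^ 2), ?_, ?_⟩
    · rw [← pow_mul, mul_comm, pow_mul, neg_one_sq, one_pow]
    · rw [← pow_mul, mul_comm, pow_mul, h, neg_eq_neg_one_mul, mul_pow]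

/-- **[IUTchII] Remark 2.5.1 (ii) p. 73, "the reciprocals of the `l`-th powers of the theta values …
correspond to the values `Θ̈(±√−1 · q_X^{j/2})`"** — element form: for every `x = ζ · q^{j²}` in the
`μ_{2l}`-orbit of the theta value (`ζ^{2l} = 1`, `q^{2l} = q̈² = q_v`), one has
`x^l · Θ̈(i · q̈^j) = ε · Θ̈(i)` with `ε² = 1`, i.e. `(x^l)^{−1} = ± Θ̈(±√−1 · q_X^{j/2}) / Θ̈(±√−1)`.
[cite: Mochizuki2012, Rmk 2.5.1 (ii) p.73] -/
theorem thetaValue_pow_mul_thetaDdot {i ζ q q2 x : 𝕜} {l : ℕ} (hi : i ^ 2 = -1) (hq2 : q2 ≠ 0)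
    (hζ : ζ ^ (2 * l) = 1) (hq : q ^ (2 * l) = q2 ^ 2) (j : ℕ) (hx : x = ζ * q ^ (j ^ 2)) :
    ∃ ε : 𝕜, ε ^ 2 = 1 ∧ x ^ l * thetaDdot q2 (i * q2 ^ j) = ε * thetaDdot q2 i := by
  obtain ⟨ε, hε, hpow⟩ := pow_sq_pow_eq_sign_mul hq j
  have hζl : (ζ ^ l) ^ 2 = 1 := by rw [← pow_mul, mul_comm, hζ]
  refine ⟨ζ ^ l * ε, ?_, ?_⟩
  · rw [mul_pow, hζl, hε, one_mul]
  · rw [hx, mul_pow, hpow, ← thetaDdot_sqrt_neg_one_mul_pow hi hq2 j]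
    ring

end Classical

section Orbit

variable {K : Type*} [NormedField K] [DecidableEq Kˣ] (l : ℕ) [Fintype (rootsOfUnity (2 * l) Kˣ)]

/-- **[IUTchII] Remark 2.5.1 (i)–(ii) pp. 72–73, for the typed orbit `thetaValueAt`**: with `H := K_v^×`
(the Kummer map `K_v^× ↪ H¹(G_v(Π_{v¨▶}), (l·Δ_Θ)(Π_{v¨▶}))` of Remark 2.5.1 (i) being injective, the orbit
may be read inside `K_v^×`), `q ∈ K_v^×` a `2l`-th root of `q̈² = q_v` and `i² = −1`: every element `x` of
`θ^j = μ_{2l} · q^{j²}` (`thetaValueAt (2l) q j`) satisfies `x^l · Θ̈(i · q̈^j) = ε · Θ̈(i)`, `ε² = 1` —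
"the reciprocals of the `l`-th powers of the theta values … correspond to the values
`Θ̈(±√−1 · q_X^{j/2})`". [cite: Mochizuki2012, Rmk 2.5.1 (ii) p.73] -/
theorem thetaValueAt_pow_mul_thetaDdot {i q2 : K} (hi : i ^ 2 = -1) (hq2 : q2 ≠ 0) (q : Kˣ)
    (hq : (q : K) ^ (2 * l) = q2 ^ 2) (j : ℕ) (x : Kˣ) (hx : x ∈ thetaValueAt (2 * l) q j) :
    ∃ ε : K, ε ^ 2 = 1 ∧ (x : K) ^ l * thetaDdot q2 (i * q2 ^ j) = ε * thetaDdot q2 i := by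
  obtain ⟨ζ, rfl⟩ := (mem_thetaValueAt (2 * l) q j x).mp hx
  have hζ : (((ζ : Kˣˣ) : Kˣ) : K) ^ (2 * l) = 1 := by
    have h := ζ.2
    rw [mem_rootsOfUnity] at h
    have h' := congrArg (fun u : Kˣˣ => (((u : Kˣˣ) : Kˣ) : K)) h
    simpa using h'
  exact thetaValue_pow_mul_thetaDdot hi hq2 hζ hq j (by push_cast; rfl)

end Orbit

end Literature.IUT.HodgeArakelov
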